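import Mathlib
import Literature.Combinatorics.Additive.TripleProductProperty
import Summits.MatrixMultiplication.MatrixMultiplication.Theses.SnSubsetDichotomy
import Summits.MatrixMultiplication.MatrixMultiplication.Theorems.SnSubsetDichotomyThresholdSubsetTriplesTwistFreeIffTpp

/-!
# Crux `SnSubsetDichotomy.ThresholdSubsetTriples` (stmt-MatrixMultiplication-10882) — the residual `C⁺` IS the crux on
# ℤ/3-symmetric witnesses (exact form)

Line lead c3 (2026-08-17), `--supports` helper (registered stub `symmetricThreshold_iff_conjugateTriples`).  The residual of
every gen-1 line of this crux is the **symmetric threshold** `C⁺` (tree: hypothesis of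
`thresholdSubsetTriples_of_symmetricThreshold`, p140745): cofinally in `n`, an element `τ ∈ S_n` with `τ³ = 1` and ONE set
`X ⊆ S_n` above `√(n!)·e^{-c√n}` whose twisted corner equation `x₁x₁'⁻¹ τ (x₂x₂'⁻¹) τ (x₃x₃'⁻¹) τ = 1` has only trivial
solutions.  The censuses describe `C⁺` as "the crux `X` restricted to ℤ/3-symmetric witnesses `(X, τXτ⁻¹, τ²Xτ⁻²)`"; with the
triality lever now landed as an EQUIVALENCE (`twistFree_iff_tpp`, p141582: twisted-corner-free ⟺
`TripleProductProperty X (τXτ⁻¹) (τ²Xτ⁻²)` for `τ³ = 1`) that description is a theorem, recorded here verbatim and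
definition-free so that a planner can file either side as an item:

* `symmetricThreshold_iff_conjugateTriples` — `C⁺ ⟺` "for every `c > 0`, cofinally in `n`, some `τ` with `τ³ = 1` and some
  `X ⊆ S_n` with `TPP(X, τXτ⁻¹, τ²Xτ⁻²)` and `|X| > √(n!)·e^{-c√n}`" — the crux `ThresholdSubsetTriples` with its witness
  triple `(S, T, U)` constrained to a conjugation orbit of `ℤ/3` (volume `|X|³`, cf. `stub_cubeThreshold`).

References: Blasiak–Church–Cohn–Grochow–Umans 2017 (arXiv:1712.02302) §4 (the open question for subsets of `S_n`; `C⁺` is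
its ℤ/3-symmetric half); Cohn–Umans 2003 Def. 2.1 (TPP); tree p140745 (`C⁺ → X`, `C⁺ ⟺ stub_blockedHosts`), p141582, p141587.
-/

-- the tree's namespace `Summit.MatrixMultiplication.MatrixMultiplication.…` repeats a component by design
set_option linter.dupNamespace false

namespace Summit.MatrixMultiplication.MatrixMultiplication.Theorems.ThresholdSubsetTriples

open Literature.Combinatorics.Additive

/-- **`C⁺` is exactly the crux on ℤ/3-symmetric witnesses.**  The symmetric threshold (cofinal twisted-corner-free sets
`X ⊆ S_n` above `√(n!)e^{-c√n}` for a twist `τ`, `τ³ = 1`) is equivalent, at the same scale `c` and with the same `n, τ, X`,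
to the existence of cofinal conjugate triples `(X, τXτ⁻¹, τ²Xτ⁻²)` with the triple product property and
`|X| > √(n!)e^{-c√n}` — by the landed lever `twistFree_iff_tpp` applied under the quantifiers. -/
theorem symmetricThreshold_iff_conjugateTriples : (∀ c : ℝ, 0 < c → ∀ n₀ : ℕ, ∃ n ≥ n₀, ∃ τ : Equiv.Perm (Fin n), τ ^ 3 = 1 ∧ ∃ X : Finset (Equiv.Perm (Fin n)), (∀ x₁ ∈ X, ∀ x₁' ∈ X, ∀ x₂ ∈ X, ∀ x₂' ∈ X, ∀ x₃ ∈ X, ∀ x₃' ∈ X, x₁ * x₁'⁻¹ * τ * (x₂ * x₂'⁻¹) * τ * (x₃ * x₃'⁻¹) * τ = 1 → x₁ = x₁' ∧ x₂ = x₂' ∧ x₃ = x₃') ∧ Real.sqrt (n.factorial : ℝ) * Real.exp (-(c * Real.sqrt (n : ℝ))) < (X.card : ℝ)) ↔ (∀ c : ℝ, 0 < c → ∀ n₀ : ℕ, ∃ n ≥ n₀, ∃ τ : Equiv.Perm (Fin n), τ ^ 3 = 1 ∧ ∃ X : Finset (Equiv.Perm (Fin n)), TripleProductProperty X (X.image (fun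 x => τ * x * τ⁻¹)) (X.image (fun x => τ ^ 2 * x * (τ ^ 2)⁻¹)) ∧ Real.sqrt (n.factorial : ℝ) * Real.exp (-(c * Real.sqrt (n : ℝ))) < (X.card : ℝ)) := by
  constructor
  · intro h c hc n₀
    obtain ⟨n, hn, τ, hτ, X, htw, hbig⟩ := h c hc n₀
    exact ⟨n, hn, τ, hτ, X, (twistFree_iff_tpp X τ hτ).1 htw, hbig⟩
  · intro h c hc n₀
    obtain ⟨n, hn, τ, hτ, X, htpp, hbig⟩ := h c hc n₀
    exact ⟨n, hn, τ, hτ, X, (twistFree_iff_tpp X τ hτ).2 htpp, hbig⟩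

end Summit.MatrixMultiplication.MatrixMultiplication.Theorems.ThresholdSubsetTriples
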